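import Summits.HodgeConjecture.HodgeConjecture.Theorems.MarkmanPartnerTransportFiniteMorphismTransport
import Literature.AlgebraicGeometry.Surfaces.K3TranscendentalLatticeSignatureHolds
import Literature.AlgebraicGeometry.Surfaces.K3PeriodSurjectivityProofs
import Literature.AlgebraicGeometry.Surfaces.GeometricGenusOneAssociatedK3Surface

/-!
# Route MarkmanPartnerTransport · crux `PicardThreeK3Squares` (stmt-HodgeConjecture-19652) —
# programme «ISOGENY DATUM», brick 4: the RELATIVE trace normalisation of two markings through a roof
# (`∫_X p = r · ∫_Y p_Y` with `r > 0`), from the `(2,0)`-classes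

Brick 3 (`…PicardThreeK3SquaresIsogenyDatum`) carries the hypothesis `htr : ∫_X p = ∫_Y p_Y` for the
integral generators `p`, `p_Y` of two markings (in reality both traces are `1`; the tree does not yet pin
`∫ p` — the absolute statement needs the identification of the rational fundamental class with the
integral one, `(μ.toCoeff ℚ).fundamentalClass = (μ.fundamentalClass) ⊗ 1`, not in the tree). This file
proves the RELATIVE half: along a roof `Y ←π— Z —f→ X` of morphisms of non-zero cohomological degrees
from a smooth projective surface `Z` of geometric genus one, the two traces have a POSITIVE REAL ratio,
so `htr` follows from `∫_X p = ± ∫_Y p_Y`: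

* `cup_conjClass_markingSymm` — `σ̄ ∪ σ = (x̄.x) • p` for the period class `σ = η⁻¹ x` of a marking;
* `traceC_cup_conj_map_marking` — `∫_Z \overline{g^*σ} ∪ g^*σ = deg g · (x̄.x) · ∫_X p`;
* `exists_pos_traceC_eq_mul_traceC` — **`∫_X p = r · ∫_Y p_Y`, `r > 0` real** (`f^*σ_X = λ π^*σ_Y` on
  the `(2,0)`-line of `Z`, `λ ≠ 0`; `(x̄.x) > 0` for both markings);
* `traceC_eq_traceC_of_roof` — `∫_X p = ± ∫_Y p_Y ⟹ ∫_X p = ∫_Y p_Y`.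

THEOREMS ONLY (no definition, no named fact, no sorry). Prover seat hodge-nonav-19652-p1 (gen 21),
`--supports stmt-HodgeConjecture-19652`. Nothing here proves an instance of the Hodge conjecture.

References: D. Huybrechts, *Lectures on K3 Surfaces* (2016), Ch. 6 §1.1 (period domain), Ch. 1
Prop. 3.5; C. Voisin, *Hodge Theory I* (2002), Cor. 6.12, §7.3.2; H. Inose, Proc. Int. Symp.
Algebraic Geometry Kyoto 1977 (1978), §2.
-/

set_option linter.dupNamespace false

noncomputable section

namespace Summit.HodgeConjecture.HodgeConjecture.Theorems.MarkmanPartnerTransport.IsogenyDatum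

open scoped Manifold
open Module CategoryTheory MonoidalCategory CartesianMonoidalCategory
open Literature.AlgebraicGeometry Literature.AlgebraicGeometry.Motives Literature.AlgebraicGeometry.HodgeTheory
open Literature.AlgebraicGeometry.Surfaces
open Literature.AlgebraicTopology.SingularHomology
open Summit.HodgeConjecture.HodgeConjecture.Theorems.MarkmanPartnerTransport.FiniteMorphism

variable {S Y Z : SchemeOver ℂ}

/-- `Deg[hZ, hX, f, d]`: `f₊ 1 = d • 1` (cohomological degree `d`, complex orientations). -/
local notation3 (prettyPrint := false) "Deg[" hZ ", " hX ", " f ", " d "]" =>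
  complexGysin complexOrientationFamily hZ hX f (rfl : 0 + 2 * 2 = 0 + 2 * 2)
      (singularCohomology.one ℂ (Motives.ComplexPoints _)) =
    (d : ℂ) • singularCohomology.one ℂ (Motives.ComplexPoints _)

/-! ### The relative trace normalisation through the roof: `∫_X p` and `∫_Y p_Y` have the same sign -/

section Sign

variable {hZ : IsSmoothProjective 2 Z} {hX : IsSmoothProjective 2 S} {hY : IsSmoothProjective 2 Y}
  {f : Z ⟶ S} {π : Z ⟶ Y} {n d : ℕ}

/-- **`σ̄ ∪ σ = (x̄.x) • p` for the `(2,0)`-class `σ = η⁻¹ x` of a marking** (`η(σ̄) = \overline{η σ}`,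
`marking_conjClass`, and the cup product is the lattice form times `p`).
[cite: Huybrechts2016K3, Ch. 6 §1.1 and Ch. 1 Prop. 3.5] -/
theorem cup_conjClass_markingSymm (η : complexBetti S (2 * 1) ≃ₗ[ℂ] (K3Index → ℂ)) (p : complexBetti S (2 * 2))
    (x : K3Index → ℂ)
    (hηint : ∀ c : complexBetti S (2 * 1), IsIntegralClass c ↔ ∃ v : K3Index → ℤ, η c = fun i => (v i : ℂ))
    (hηcup : ∀ a b : complexBetti S (2 * 1),
      cupProduct (rfl : 2 * 1 + 2 * 1 = 2 * 2) a b = k3Form (η a) (η b) • p) :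
    cupProduct (rfl : 2 * 1 + 2 * 1 = 2 * 2) (conjClass (Motives.ComplexPoints S) (2 * 1) (η.symm x)) (η.symm x) =
      k3Form (star x) x • p := by
  rw [hηcup, marking_conjClass η hηint, LinearEquiv.apply_symm_apply]

/-- **`∫_Z \overline{g^* σ} ∪ g^* σ = deg g · (x̄.x) · ∫ p`** for a marking `(η, p, x)` of the target of
`g : Z ⟶ X` of cohomological degree `e` (conjugation and cup product commute with `g^*`; `∫_Z g^* = e ∫_X`).
[cite: VoisinHodgeI2002, Cor. 6.12 and §7.3.2] [cite: FultonYoungTableaux1997, Appendix B §B.1 (5)–(6)] -/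
theorem traceC_cup_conj_map_marking {W : SchemeOver ℂ} (hW : IsSmoothProjective 2 W) {g : Z ⟶ W} {e : ℕ}
    (hdeg : Deg[hZ, hW, g, e])
    (η : complexBetti W (2 * 1) ≃ₗ[ℂ] (K3Index → ℂ)) (p : complexBetti W (2 * 2)) (x : K3Index → ℂ)
    (hηint : ∀ c : complexBetti W (2 * 1), IsIntegralClass c ↔ ∃ v : K3Index → ℤ, η c = fun i => (v i : ℂ))
    (hηcup : ∀ a b : complexBetti W (2 * 1),
      cupProduct (rfl : 2 * 1 + 2 * 1 = 2 * 2) a b = k3Form (η a) (η b) • p) :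
    traceC hZ (cupProduct (rfl : 2 * 1 + 2 * 1 = 2 * 2)
        (conjClass (Motives.ComplexPoints Z) (2 * 1) (complexBetti.map g (2 * 1) (η.symm x)))
        (complexBetti.map g (2 * 1) (η.symm x))) =
      (e : ℂ) * (k3Form (star x) x * traceC hW p) := by
  have h1 : conjClass (Motives.ComplexPoints Z) (2 * 1) (complexBetti.map g (2 * 1) (η.symm x)) =
      complexBetti.map g (2 * 1) (conjClass (Motives.ComplexPoints W) (2 * 1) (η.symm x)) :=
    conjClass_map (Motives.AlgPoints.mapContinuous (L := ℂ) g) _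
  rw [h1]
  change traceC hZ (cupProduct (rfl : 2 * 1 + 2 * 1 = 2 * 2)
      (singularCohomology.map ℂ ℂ (Motives.AlgPoints.mapContinuous (L := ℂ) g) (2 * 1) _)
      (singularCohomology.map ℂ ℂ (Motives.AlgPoints.mapContinuous (L := ℂ) g) (2 * 1) _)) = _
  rw [← cupProduct_map, cup_conjClass_markingSymm η p x hηint hηcup, map_smul, map_smul, smul_eq_mul]
  change k3Form (star x) x * traceC hZ (complexBetti.map g (2 * 2) p) = _
  rw [traceC_map_eq hdeg]
  ring

/-- **Relative sign of the generators through a roof.** For markings `(η, p, x)` of `X` and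
`(η_Y, p_Y, x_Y)` of `Y` (integral lattices, cup product = lattice form `• p`, period `x` spanning the
`(2,0)`-classes with `(x̄.x) > 0`), a smooth projective surface `Z` of geometric genus one and morphisms
`f : Z ⟶ X`, `π : Z ⟶ Y` of cohomological degrees `n, d ≠ 0`: **`∫_X p = r · ∫_Y p_Y` with `r > 0`
REAL.** Proof: `f^*σ_X = λ π^*σ_Y` on the `(2,0)`-line of `Z` (`λ ≠ 0`), so
`n (x̄.x) ∫_X p = ∫_Z \overline{f^*σ_X} ∪ f^*σ_X = |λ|² ∫_Z \overline{π^*σ_Y} ∪ π^*σ_Y = |λ|² d (x̄_Y.x_Y) ∫_Y p_Y`.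
[cite: Huybrechts2016K3, Ch. 6 §1.1 (period domain) and Ch. 3 Lemma 3.1] [cite: Inose1978, §2] -/
theorem exists_pos_traceC_eq_mul_traceC (hdegf : Deg[hZ, hX, f, n]) (hn : n ≠ 0)
    (hdegπ : Deg[hZ, hY, π, d]) (hd : d ≠ 0) (h1Z : HasGeometricGenusOne Z)
    (η : complexBetti S (2 * 1) ≃ₗ[ℂ] (K3Index → ℂ)) (p : complexBetti S (2 * 2)) (x : K3Index → ℂ)
    (hηint : ∀ c : complexBetti S (2 * 1), IsIntegralClass c ↔ ∃ v : K3Index → ℤ, η c = fun i => (v i : ℂ))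
    (hηcup : ∀ a b : complexBetti S (2 * 1),
      cupProduct (rfl : 2 * 1 + 2 * 1 = 2 * 2) a b = k3Form (η a) (η b) • p)
    (hx20 : IsOfHodgeType 2 S (2 * 1) 2 0 (η.symm x)) (hxpos : 0 < (k3Form (star x) x).re)
    (ηY : complexBetti Y (2 * 1) ≃ₗ[ℂ] (K3Index → ℂ)) (pY : complexBetti Y (2 * 2)) (xY : K3Index → ℂ)
    (hηYint : ∀ c : complexBetti Y (2 * 1), IsIntegralClass c ↔ ∃ v : K3Index → ℤ, ηY c = fun i => (v i : ℂ))
    (hηYcup : ∀ a b : complexBetti Y (2 * 1),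
      cupProduct (rfl : 2 * 1 + 2 * 1 = 2 * 2) a b = k3Form (ηY a) (ηY b) • pY)
    (hxY20 : IsOfHodgeType 2 Y (2 * 1) 2 0 (ηY.symm xY)) (hxYpos : 0 < (k3Form (star xY) xY).re) :
    ∃ r : ℝ, 0 < r ∧ traceC hX p = (r : ℂ) * traceC hY pY := by
  have hfinj := map_injective_of_deg hdegf (Nat.cast_ne_zero.2 hn) (2 * 1)
  have hπinj := map_injective_of_deg hdegπ (Nat.cast_ne_zero.2 hd) (2 * 1)
  -- the periods are non-zero
  have hx0 : η.symm x ≠ 0 := by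
    intro h
    have hx : x = 0 := by simpa using congrArg η h
    rw [hx, star_zero, k3Form_zero_right] at hxpos
    simp at hxpos
  have hxY0 : ηY.symm xY ≠ 0 := by
    intro h
    have hx : xY = 0 := by simpa using congrArg ηY h
    rw [hx, star_zero, k3Form_zero_right] at hxYpos
    simp at hxYpos
  -- `f^*σ_X = λ • π^*σ_Y` on the `(2,0)`-line of `Z`
  obtain ⟨ω₀, hω₀0, -, hline⟩ := h1Z
  obtain ⟨s, hs⟩ := hline _ (hx20.map_of_isSmoothProjective hZ hX f)
  obtain ⟨t, ht⟩ := hline _ (hxY20.map_of_isSmoothProjective hZ hY π)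
  have hs0 : s ≠ 0 := by
    rintro rfl
    exact hx0 (hfinj (by rw [hs, zero_smul, map_zero]))
  have ht0 : t ≠ 0 := by
    rintro rfl
    exact hxY0 (hπinj (by rw [ht, zero_smul, map_zero]))
  set lam : ℂ := s * t⁻¹ with hlam
  have hlam0 : lam ≠ 0 := mul_ne_zero hs0 (inv_ne_zero ht0)
  have hrel : complexBetti.map f (2 * 1) (η.symm x) = lam • complexBetti.map π (2 * 1) (ηY.symm xY) := by
    rw [hs, ht, smul_smul, hlam, inv_mul_cancel_right₀ ht0]
  -- the two evaluations of `∫_Z \overline{f^*σ_X} ∪ f^*σ_X`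
  have hE1 := traceC_cup_conj_map_marking (hZ := hZ) hX hdegf η p x hηint hηcup
  have hE2 := traceC_cup_conj_map_marking (hZ := hZ) hY hdegπ ηY pY xY hηYint hηYcup
  rw [hrel, conjClass_smul, LinearMap.map_smul₂, map_smul, map_smul, map_smul, smul_eq_mul, smul_eq_mul,
    hE2] at hE1
  -- realness of the lattice self-pairings and `|λ|²`
  have hA : k3Form (star x) x = ((k3Form (star x) x).re : ℂ) := by
    apply Complex.ext <;> simp [k3Form_star_self_im x]
  have hAY : k3Form (star xY) xY = ((k3Form (star xY) xY).re : ℂ) := by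
    apply Complex.ext <;> simp [k3Form_star_self_im xY]
  have hnl : starRingEnd ℂ lam * lam = ((Complex.normSq lam : ℝ) : ℂ) := by
    rw [Complex.normSq_eq_conj_mul_self]
  set A : ℝ := (k3Form (star x) x).re with hAdef
  set AY : ℝ := (k3Form (star xY) xY).re with hAYdef
  set N : ℝ := Complex.normSq lam with hNdef
  have hN : 0 < N := Complex.normSq_pos.2 hlam0
  -- `n A ∫p = N d A_Y ∫p_Y`
  have hE : (n : ℂ) * ((A : ℂ) * traceC hX p) = (N : ℂ) * ((d : ℂ) * ((AY : ℂ) * traceC hY pY)) := by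
    rw [← hA, ← hAY, ← hnl]
    linear_combination -hE1
  refine ⟨N * d * AY / (n * A), by positivity, ?_⟩
  have hnA : (n : ℂ) * (A : ℂ) ≠ 0 :=
    mul_ne_zero (Nat.cast_ne_zero.2 hn) (by exact_mod_cast hxpos.ne')
  push_cast
  rw [div_mul_eq_mul_div, eq_div_iff hnA]
  linear_combination hE

/-- **`∫_X p = ∫_Y p_Y` through a roof, granted `∫_X p = ± ∫_Y p_Y`** (the absolute trace normalisation
of integral generators — in reality both are `1` — composed with the relative sign of
`exists_pos_traceC_eq_mul_traceC`). [cite: Huybrechts2016K3, Ch. 6 §1.1] [cite: HatcherAT2002, §3.3 Thm. 3.30] -/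
theorem traceC_eq_traceC_of_roof (hdegf : Deg[hZ, hX, f, n]) (hn : n ≠ 0)
    (hdegπ : Deg[hZ, hY, π, d]) (hd : d ≠ 0) (h1Z : HasGeometricGenusOne Z)
    (η : complexBetti S (2 * 1) ≃ₗ[ℂ] (K3Index → ℂ)) (p : complexBetti S (2 * 2)) (x : K3Index → ℂ)
    (hηint : ∀ c : complexBetti S (2 * 1), IsIntegralClass c ↔ ∃ v : K3Index → ℤ, η c = fun i => (v i : ℂ))
    (hηcup : ∀ a b : complexBetti S (2 * 1),
      cupProduct (rfl : 2 * 1 + 2 * 1 = 2 * 2) a b = k3Form (η a) (η b) • p)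
    (hx20 : IsOfHodgeType 2 S (2 * 1) 2 0 (η.symm x)) (hxpos : 0 < (k3Form (star x) x).re)
    (ηY : complexBetti Y (2 * 1) ≃ₗ[ℂ] (K3Index → ℂ)) (pY : complexBetti Y (2 * 2)) (xY : K3Index → ℂ)
    (hηYint : ∀ c : complexBetti Y (2 * 1), IsIntegralClass c ↔ ∃ v : K3Index → ℤ, ηY c = fun i => (v i : ℂ))
    (hηYcup : ∀ a b : complexBetti Y (2 * 1),
      cupProduct (rfl : 2 * 1 + 2 * 1 = 2 * 2) a b = k3Form (ηY a) (ηY b) • pY)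
    (hxY20 : IsOfHodgeType 2 Y (2 * 1) 2 0 (ηY.symm xY)) (hxYpos : 0 < (k3Form (star xY) xY).re)
    (hpY0 : traceC hY pY ≠ 0)
    (habs : traceC hX p = traceC hY pY ∨ traceC hX p = -traceC hY pY) :
    traceC hX p = traceC hY pY := by
  rcases habs with h | h
  · exact h
  obtain ⟨r, hr, hrr⟩ := exists_pos_traceC_eq_mul_traceC hdegf hn hdegπ hd h1Z η p x hηint hηcup hx20 hxpos
    ηY pY xY hηYint hηYcup hxY20 hxYpos
  exfalso
  rw [h] at hrr
  have h1 : ((r : ℂ) + 1) * traceC hY pY = 0 := by linear_combination -hrr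
  rcases mul_eq_zero.1 h1 with h2 | h2
  · have h3 : (r : ℝ) + 1 = 0 := by exact_mod_cast h2
    linarith
  · exact hpY0 h2

end Sign

end Summit.HodgeConjecture.HodgeConjecture.Theorems.MarkmanPartnerTransport.IsogenyDatum

end
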